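import Literature.Probability.LatticeModels.SpinPolygonGeometry
import Literature.Probability.LatticeModels.MedialTraversalSectors
import HarnessLib

/-!
# The polygon of the leftmost Ising interface inside a discretised Jordan domain: the cut set

Topic `Literature/Probability/LatticeModels` (trunk `StatMech`, family `crit-ising`). For the
leftmost Dobrushin interface of a spin configuration in admissible square-lattice Dobrushin data
`D` on a Jordan domain (`D.Ω = Dm.carrier`), the **cut set** `leftCut D σ` is the union of the
pieces `δ • leftChord D σ k`, `1 ≤ k ≤ N - 2`, of its polygon (all pieces except the first and the
last, so that every endpoint used is the midpoint of a side shared by two *inner* faces). This file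
proves the four facts about it consumed by the sector argument (Aizenman–Burchard 1999, App. A;
the FK sibling is `MedialTraversalSectors.lean`, whose perturbed polygon plays the role of the cut
set):

* `crossedEdge_of_mem_leftPiece_of_mem_segment` — a lattice edge whose segment meets a piece is one
  of the two edges crossed at the ends of the piece; hence **edges between two `+` sites miss the
  cut set** (`segment_disjoint_leftPiece_of_isPlus`), and a lattice edge meeting the cut set is an
  edge of `Ω_δ` (`adj_of_mem_leftCut_of_mem_segment`);
* `isInnerFace_of_mem_leftPiece_closedSq` — a closed face meeting the cut set is inner;
* `leftCut_subset_carrier` — **the cut set lies in the domain** (open inner faces lie in the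
  domain by the Jordan curve theorem, `Percolation.mem_carrier_of_mem_openSq`; the midpoint of a
  side shared by two inner faces lies in the open `1 × 2` rectangle they form,
  `mem_carrier_of_midpoint_inner`), so it misses `∂D`;
* `exists_frontier_near_of_mem_zdBoundary_leftCut` — every site of the discrete boundary is
  joined to a point of `∂D` within `2δ` by a segment missing the cut set (as in the FK sibling,
  through a non-inner face or a missing edge).

Everything is proved.

## References

* M. Aizenman, A. Burchard, Duke Math. J. 99 (1999), Appendix A. [AizenmanBurchardDuke1999]
* D. Chelkak, H. Duminil-Copin, C. Hongler, A. Kemppainen, S. Smirnov, C. R. Math. Acad. Sci.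
  Paris 352 (2014), §1. [CDHKSCRAS2014]
* S. Smirnov, C. R. Acad. Sci. Paris 333 (2001), §2 (discrete domains). [Smirnov2001]
-/

noncomputable section

namespace Literature.Probability.LatticeModels

open Set Metric Complex Literature.Probability.Percolation Literature.Topology.PlaneTopology
open scoped Pointwise

variable {D : DiscreteDobrushin}

/-! ### Pieces and the cut set in the plane -/

/-- The **`k`-th piece of the polygon of the leftmost interface** in the plane (mesh `δ`): the
segment between the `k`-th and `(k+1)`-st polygon vertices. [cite: CDHKSCRAS2014, §1] -/
def leftPiece (D : DiscreteDobrushin) (σ : SpinConfig (Site 2)) (k : ℕ) : Set ℂ := D.δ • leftChord D σ k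

/-- The **cut set** of the leftmost interface: the pieces `1 ≤ k ≤ N - 2` of its polygon.
[cite: AizenmanBurchardDuke1999, Appendix A] -/
def leftCut (D : DiscreteDobrushin) (σ : SpinConfig (Site 2)) : Set ℂ :=
  ⋃ k ∈ Finset.Icc 1 (leftLength D σ - 2), leftPiece D σ k

variable (σ : SpinConfig (Site 2))

/-- The piece is the segment between consecutive polygon vertices `dualMedialPoint δ {orb k, orb (k+1)}`.
[cite: CDHKSCRAS2014, §1] -/
theorem leftPiece_eq_segment (k : ℕ) :
    leftPiece D σ k = segment ℝ (dualMedialPoint D.δ s(leftOrbit D σ k, leftOrbit D σ (k + 1)))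
      (dualMedialPoint D.δ s(leftOrbit D σ (k + 1), leftOrbit D σ (k + 1 + 1))) := by
  rw [leftPiece, leftChord, smul_segment_eq, dualMedialPoint_leftOrbit, dualMedialPoint_leftOrbit, Complex.real_smul,
    Complex.real_smul]

variable {σ}

/-- Membership in a piece, in lattice units. [folklore] -/
theorem mem_leftPiece_iff (hδ : D.δ ≠ 0) {σ : SpinConfig (Site 2)} {k : ℕ} {z : ℂ} :
    z ∈ leftPiece D σ k ↔ D.δ⁻¹ • z ∈ leftChord D σ k :=
  Set.mem_smul_set_iff_inv_smul_mem₀ hδ _ _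

/-- Membership in the cut set. [folklore] -/
theorem mem_leftCut_iff {σ : SpinConfig (Site 2)} {z : ℂ} :
    z ∈ leftCut D σ ↔ ∃ k, 1 ≤ k ∧ k + 2 ≤ leftLength D σ ∧ z ∈ leftPiece D σ k := by
  simp only [leftCut, mem_iUnion, Finset.mem_Icc, exists_prop]
  constructor
  · rintro ⟨k, ⟨h1, h2⟩, hz⟩
    have hN : 3 ≤ leftLength D σ ∨ leftLength D σ - 2 = 0 := by omega
    rcases hN with hN | hN
    · exact ⟨k, h1, by omega, hz⟩
    · omega
  · rintro ⟨k, h1, h2, hz⟩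
    exact ⟨k, ⟨h1, by omega⟩, hz⟩

/-! ### Lattice edges against the pieces -/

/-- **A lattice edge whose segment meets the `k`-th piece is one of the two edges crossed at its
ends** (lattice edges avoid open faces, so the common point is an endpoint of the piece, i.e. the
midpoint of a crossed edge, which determines the edge). [cite: CDHKSCRAS2014, §1] -/
theorem crossedEdge_of_mem_leftPiece_of_mem_segment (hD : D.IsZdAdmissible) (σ : SpinConfig (Site 2)) {k : ℕ}
    (hk : k + 1 ≤ leftLength D σ) {u w : Site 2} (huw : (zdGraph 2).Adj u w) {z : ℂ} (hz : z ∈ leftPiece D σ k)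
    (hzs : z ∈ segment ℝ (meshPoint D.δ u) (meshPoint D.δ w)) :
    ∃ m, (m = k ∨ m = k + 1) ∧ s(u, w) = s(leftSite D σ m, dualDartRight (leftOrbit D σ m) (leftOrbit D σ (m + 1))) ∧
      D.δ⁻¹ • z = leftVert D σ m := by
  have hδ := hD.delta_pos
  rw [mem_leftPiece_iff hδ.ne'] at hz
  rw [meshPoint_eq_smul, meshPoint_eq_smul, mem_segment_smul_iff hδ.ne'] at hzs
  have hnot : D.δ⁻¹ • z ∉ openSq (leftOrbit D σ (k + 1)) :=
    fun h ↦ Set.disjoint_left.1 (segment_toComplex_disjoint_openSq huw _) hzs h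
  have key : ∀ m, m ≤ leftLength D σ → D.δ⁻¹ • z = leftVert D σ m →
      s(u, w) = s(leftSite D σ m, dualDartRight (leftOrbit D σ m) (leftOrbit D σ (m + 1))) := by
    intro m hm he
    have hadj : (zdGraph 2).Adj (leftSite D σ m) (dualDartRight (leftOrbit D σ m) (leftOrbit D σ (m + 1))) :=
      meshGraph_le_zdGraph _ _ (discreteDomainGraph_le_meshGraph _ _ (adj_leftSite_dualDartRight hD σ hm))
    rw [he, leftVert_eq_midpoint hD σ hm] at hzs
    exact (eq_of_midpoint_mem_segment hadj huw hzs).symm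
  rcases eq_leftVert_of_not_mem_openSq hD σ hk hz hnot with he | he
  · exact ⟨k, Or.inl rfl, key k (Nat.le_of_succ_le hk) he, he⟩
  · exact ⟨k + 1, Or.inr rfl, key (k + 1) hk he, he⟩

/-- **An edge between two `+` sites misses every piece** (the crossed edges have a `−` endpoint).
[cite: CDHKSCRAS2014, §1] -/
theorem segment_disjoint_leftPiece_of_isPlus (hD : D.IsZdAdmissible) (σ : SpinConfig (Site 2)) {k : ℕ}
    (hk : k + 1 ≤ leftLength D σ) {u w : Site 2} (huw : (zdGraph 2).Adj u w) (hu : D.IsPlus σ u) (hw : D.IsPlus σ w) :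
    Disjoint (segment ℝ (meshPoint D.δ u) (meshPoint D.δ w)) (leftPiece D σ k) := by
  refine Set.disjoint_left.2 fun z hzs hz ↦ ?_
  obtain ⟨m, hm, he, -⟩ := crossedEdge_of_mem_leftPiece_of_mem_segment hD σ hk huw hz hzs
  have hmN : m ≤ leftLength D σ := by rcases hm with rfl | rfl <;> omega
  have hminus := (leftOrbit_valid hD σ hmN).2.2.2
  have hR : dualDartRight (leftOrbit D σ m) (leftOrbit D σ (m + 1)) ∈ s(u, w) := by rw [he]; exact Sym2.mem_mk_right _ _
  rcases Sym2.mem_iff.1 hR with h | h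
  · exact hminus (h ▸ hu)
  · exact hminus (h ▸ hw)

/-- An edge between two `+` sites misses the cut set. [cite: CDHKSCRAS2014, §1] -/
theorem segment_disjoint_leftCut_of_isPlus (hD : D.IsZdAdmissible) (σ : SpinConfig (Site 2)) {u w : Site 2}
    (huw : (zdGraph 2).Adj u w) (hu : D.IsPlus σ u) (hw : D.IsPlus σ w) :
    Disjoint (segment ℝ (meshPoint D.δ u) (meshPoint D.δ w)) (leftCut D σ) := by
  refine Set.disjoint_left.2 fun z hzs hz ↦ ?_
  obtain ⟨k, -, hk, hz⟩ := mem_leftCut_iff.1 hz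
  exact Set.disjoint_left.1 (segment_disjoint_leftPiece_of_isPlus hD σ (by omega) huw hu hw) hzs hz

/-- **A lattice edge meeting the cut set is an edge of `Ω_δ`** (it is a crossed edge).
[cite: Smirnov2001, §2] -/
theorem adj_of_mem_leftCut_of_mem_segment (hD : D.IsZdAdmissible) (σ : SpinConfig (Site 2)) {u w : Site 2}
    (huw : (zdGraph 2).Adj u w) {z : ℂ} (hz : z ∈ leftCut D σ) (hzs : z ∈ segment ℝ (meshPoint D.δ u) (meshPoint D.δ w)) :
    (discreteDomainGraph D.Ω D.δ).Adj u w := by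
  obtain ⟨k, -, hk, hz⟩ := mem_leftCut_iff.1 hz
  obtain ⟨m, hm, he, -⟩ := crossedEdge_of_mem_leftPiece_of_mem_segment hD σ (by omega) huw hz hzs
  have hmN : m ≤ leftLength D σ := by rcases hm with rfl | rfl <;> omega
  have hG := adj_leftSite_dualDartRight hD σ hmN
  have hne := huw.ne
  rcases Sym2.eq_iff.1 he with ⟨h1, h2⟩ | ⟨h1, h2⟩
  · rw [h1, h2]; exact hG
  · rw [h1, h2]; exact hG.symm

/-! ### Faces meeting the cut set are inner -/

/-- **A closed face meeting a piece `1 ≤ k ≤ N - 2` is inner**: an inner point of the piece lies in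
the open face `orb (k+1)`, which meets no other closed face; an endpoint is the midpoint of a side
whose two faces are consecutive faces of the orbit, inner. [cite: Smirnov2001, §2] -/
theorem isInnerFace_of_mem_leftPiece_closedSq (hD : D.IsZdAdmissible) (σ : SpinConfig (Site 2)) {k : ℕ}
    (h1 : 1 ≤ k) (hk : k + 2 ≤ leftLength D σ) {z : ℂ} (hz : z ∈ leftPiece D σ k) {g : Site 2}
    (hg : D.δ⁻¹ • z ∈ closedSq g) : D.IsInnerFace g := by
  have hδ := hD.delta_pos
  rw [mem_leftPiece_iff hδ.ne'] at hz
  by_cases hopen : D.δ⁻¹ • z ∈ openSq (leftOrbit D σ (k + 1))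
  · rw [eq_of_mem_openSq_of_mem_closedSq hopen hg]
    exact isInnerFace_leftOrbit hD σ (Nat.succ_pos k) (by omega)
  · rcases eq_leftVert_of_not_mem_openSq hD σ (by omega) hz hopen with he | he <;> rw [he, leftVert] at hg
    · rcases eq_faces_of_midpoint_mem_closedSq (leftOrbit_valid hD σ (by omega)).1 hg with rfl | rfl
      · exact isInnerFace_leftOrbit hD σ h1 (by omega)
      · exact isInnerFace_leftOrbit hD σ (Nat.succ_pos k) (by omega)
    · rcases eq_faces_of_midpoint_mem_closedSq (leftOrbit_valid hD σ (by omega)).1 hg with rfl | rfl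
      · exact isInnerFace_leftOrbit hD σ (Nat.succ_pos k) (by omega)
      · exact isInnerFace_leftOrbit hD σ (Nat.succ_pos _) (by omega)

/-- A closed face meeting the cut set is inner. [cite: Smirnov2001, §2] -/
theorem isInnerFace_of_mem_leftCut_closedSq (hD : D.IsZdAdmissible) (σ : SpinConfig (Site 2)) {z : ℂ}
    (hz : z ∈ leftCut D σ) {g : Site 2} (hg : D.δ⁻¹ • z ∈ closedSq g) : D.IsInnerFace g := by
  obtain ⟨k, h1, hk, hz⟩ := mem_leftCut_iff.1 hz
  exact isInnerFace_of_mem_leftPiece_closedSq hD σ h1 hk hz hg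

/-! ### The cut set lies in the domain -/

section Carrier

variable {Dm : RandomPlanarGeometry.DobrushinDomain}

/-- **The midpoint of a side shared by two inner faces lies in the domain**: the open `1 × 2`
rectangle formed by the two faces has its sides in `closure D` (sides of inner faces), hence lies
in `D` (Jordan curve theorem, `JordanDomain.openRect_subset_of_sides_subset_closure`), and contains
the midpoint. [cite: Smirnov2001, §2] -/
theorem mem_carrier_of_midpoint_inner (hΩ : D.Ω = Dm.carrier) (hδ : 0 < D.δ) {f F : Site 2}
    (hadj : (zdGraph 2).Adj f F) (hf : D.IsInnerFace f) (hF : D.IsInnerFace F) :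
    D.δ • ((faceCenter f + faceCenter F) / 2) ∈ Dm.carrier := by
  obtain ⟨Ω', δ, A', B'⟩ := D
  cases hΩ
  change 0 < δ at hδ
  change δ • ((faceCenter f + faceCenter F) / 2) ∈ Dm.carrier
  have hf' : (dobrushinData Dm δ).IsInnerFace f := hf
  have hF' : (dobrushinData Dm δ).IsInnerFace F := hF
  -- w.l.o.g. `F = f + eᵢ`
  wlog hdir : ∃ i : Fin 2, F = f + Pi.single i 1 generalizing f F
  · obtain ⟨i, hi⟩ := (zdGraph_adj_iff f F).1 hadj
    rcases hi with hi | hi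
    · exact this hadj hf hF hf' hF' ⟨i, hi⟩
    · rw [add_comm]
      exact this hadj.symm hF hf hF' hf' ⟨i, hi⟩
  obtain ⟨i, rfl⟩ := hdir
  obtain ⟨j, hji⟩ : ∃ j : Fin 2, j ≠ i := ⟨i + 1, by fin_cases i <;> decide⟩
  -- coordinates helper
  have hcoord : ∀ (w : ℂ) (k : Fin 2), coordVec (δ⁻¹ • w) k = δ⁻¹ * coordVec w k := fun w k => by
    rcases fin_two_eq_zero_or_one k with rfl | rfl <;> simp
  -- sides of the rectangle: constant `i`-coordinate `f i` or `f i + 2`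
  have hsideI : ∀ w : ℂ, (coordVec (δ⁻¹ • w) i = f i ∨ coordVec (δ⁻¹ • w) i = f i + 2) →
      (f j : ℝ) ≤ coordVec (δ⁻¹ • w) j → coordVec (δ⁻¹ • w) j ≤ f j + 1 → w ∈ closure Dm.carrier := by
    intro w hw h1 h2
    rcases hw with hw | hw
    · exact mem_closure_of_on_side hδ hf' (i := j) (j := i) (Ne.symm hji) (σ := 0) (by norm_num)
        (by rw [hw]; simp) h1 h2
    · refine mem_closure_of_on_side hδ hF' (i := j) (j := i) (Ne.symm hji) (σ := 1) le_rfl ?_ ?_ ?_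
      · rw [hw, Pi.add_apply, Pi.single_eq_same]; push_cast; ring
      · rw [Pi.add_apply, Pi.single_eq_of_ne hji]; simpa using h1
      · rw [Pi.add_apply, Pi.single_eq_of_ne hji]; simpa using h2
  -- sides with constant `j`-coordinate: split at `f i + 1` between the two faces
  have hsideJ : ∀ w : ℂ, (coordVec (δ⁻¹ • w) j = f j ∨ coordVec (δ⁻¹ • w) j = f j + 1) →
      (f i : ℝ) ≤ coordVec (δ⁻¹ • w) i → coordVec (δ⁻¹ • w) i ≤ f i + 2 → w ∈ closure Dm.carrier := by
    intro w hw h1 h2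
    rcases le_total (coordVec (δ⁻¹ • w) i) (f i + 1) with hwi | hwi
    · rcases hw with hw | hw
      · exact mem_closure_of_on_side hδ hf' (i := i) (j := j) hji (σ := 0) (by norm_num) (by rw [hw]; simp) h1 hwi
      · exact mem_closure_of_on_side hδ hf' (i := i) (j := j) hji (σ := 1) le_rfl (by rw [hw]; simp) h1 hwi
    · rcases hw with hw | hw
      · refine mem_closure_of_on_side hδ hF' (i := i) (j := j) hji (σ := 0) (by norm_num) ?_ ?_ ?_
        · rw [hw, Pi.add_apply, Pi.single_eq_of_ne hji]; simp
        · rw [Pi.add_apply, Pi.single_eq_same]; push_cast; exact hwi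
        · rw [Pi.add_apply, Pi.single_eq_same]; push_cast; linarith
      · refine mem_closure_of_on_side hδ hF' (i := i) (j := j) hji (σ := 1) le_rfl ?_ ?_ ?_
        · rw [hw, Pi.add_apply, Pi.single_eq_of_ne hji]; simp
        · rw [Pi.add_apply, Pi.single_eq_same]; push_cast; exact hwi
        · rw [Pi.add_apply, Pi.single_eq_same]; push_cast; linarith
  -- the midpoint in coordinates
  have hmidI : coordVec ((faceCenter f + faceCenter (f + Pi.single i 1)) / 2) i = f i + 1 := by
    have : (faceCenter f + faceCenter (f + Pi.single i 1)) / 2 = (1 / 2 : ℝ) • (faceCenter f + faceCenter (f + Pi.single i 1)) := by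
      rw [Complex.real_smul]; push_cast; ring
    rw [this, coordVec_smul, coordVec_add, coordVec_faceCenter, coordVec_faceCenter, Pi.add_apply, Pi.single_eq_same]
    push_cast; ring
  have hmidJ : coordVec ((faceCenter f + faceCenter (f + Pi.single i 1)) / 2) j = f j + 1 / 2 := by
    have : (faceCenter f + faceCenter (f + Pi.single i 1)) / 2 = (1 / 2 : ℝ) • (faceCenter f + faceCenter (f + Pi.single i 1)) := by
      rw [Complex.real_smul]; push_cast; ring
    rw [this, coordVec_smul, coordVec_add, coordVec_faceCenter, coordVec_faceCenter, Pi.add_apply, Pi.single_eq_of_ne hji]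
    push_cast; ring
  have hsmul : ∀ k, coordVec (δ • ((faceCenter f + faceCenter (f + Pi.single i 1)) / 2)) k =
      δ * coordVec ((faceCenter f + faceCenter (f + Pi.single i 1)) / 2) k := fun k ↦ coordVec_smul _ _ _
  rcases fin_two_eq_other hji with ⟨rfl, rfl⟩ | ⟨rfl, rfl⟩
  · -- `i = 0`: rectangle `(δ f0, δ(f0+2)) × (δ f1, δ(f1+1))`
    have key := Dm.openRect_subset_of_sides_subset_closure (x₁ := δ * f 0) (x₂ := δ * (f 0 + 2))
      (y₁ := δ * f 1) (y₂ := δ * (f 1 + 1)) ?_ ?_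
    · apply key
      have h0 := hsmul 0; have h1 := hsmul 1
      rw [hmidI] at h0; rw [hmidJ] at h1
      simp only [coordVec_zero, coordVec_one] at h0 h1
      refine ⟨⟨?_, ?_⟩, ?_, ?_⟩ <;> [rw [h0]; rw [h0]; rw [h1]; rw [h1]] <;> nlinarith
    · intro w hw h1 h2
      refine hsideI w ?_ ?_ ?_
      · rcases hw with hw | hw
        · left; rw [hcoord, coordVec_zero, hw]; field_simp
        · right; rw [hcoord, coordVec_zero, hw]; field_simp
      · rw [hcoord, coordVec_one, le_inv_mul_iff₀ hδ]; exact h1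
      · rw [hcoord, coordVec_one, inv_mul_le_iff₀ hδ]; exact h2
    · intro w hw h1 h2
      refine hsideJ w ?_ ?_ ?_
      · rcases hw with hw | hw
        · left; rw [hcoord, coordVec_one, hw]; field_simp
        · right; rw [hcoord, coordVec_one, hw]; field_simp
      · rw [hcoord, coordVec_zero, le_inv_mul_iff₀ hδ]; exact h1
      · rw [hcoord, coordVec_zero, inv_mul_le_iff₀ hδ]; exact h2
  · -- `i = 1`: rectangle `(δ f0, δ(f0+1)) × (δ f1, δ(f1+2))`
    have key := Dm.openRect_subset_of_sides_subset_closure (x₁ := δ * f 0) (x₂ := δ * (f 0 + 1))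
      (y₁ := δ * f 1) (y₂ := δ * (f 1 + 2)) ?_ ?_
    · apply key
      have h0 := hsmul 0; have h1 := hsmul 1
      rw [hmidJ] at h0; rw [hmidI] at h1
      simp only [coordVec_zero, coordVec_one] at h0 h1
      refine ⟨⟨?_, ?_⟩, ?_, ?_⟩ <;> [rw [h0]; rw [h0]; rw [h1]; rw [h1]] <;> nlinarith
    · intro w hw h1 h2
      refine hsideJ w ?_ ?_ ?_
      · rcases hw with hw | hw
        · left; rw [hcoord, coordVec_zero, hw]; field_simp
        · right; rw [hcoord, coordVec_zero, hw]; field_simp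
      · rw [hcoord, coordVec_one, le_inv_mul_iff₀ hδ]; exact h1
      · rw [hcoord, coordVec_one, inv_mul_le_iff₀ hδ]; exact h2
    · intro w hw h1 h2
      refine hsideI w ?_ ?_ ?_
      · rcases hw with hw | hw
        · left; rw [hcoord, coordVec_one, hw]; field_simp
        · right; rw [hcoord, coordVec_one, hw]; field_simp
      · rw [hcoord, coordVec_zero, le_inv_mul_iff₀ hδ]; exact h1
      · rw [hcoord, coordVec_zero, inv_mul_le_iff₀ hδ]; exact h2

/-- **The pieces `1 ≤ k ≤ N - 2` lie in the domain.** [cite: Smirnov2001, §2] -/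
theorem leftPiece_subset_carrier (hΩ : D.Ω = Dm.carrier) (hD : D.IsZdAdmissible) (σ : SpinConfig (Site 2)) {k : ℕ}
    (h1 : 1 ≤ k) (hk : k + 2 ≤ leftLength D σ) : leftPiece D σ k ⊆ Dm.carrier := by
  have hδ := hD.delta_pos
  intro z hz
  have hz' := (mem_leftPiece_iff hδ.ne').1 hz
  have hzeq : z = D.δ • (D.δ⁻¹ • z) := (smul_inv_smul₀ hδ.ne' z).symm
  by_cases hopen : D.δ⁻¹ • z ∈ openSq (leftOrbit D σ (k + 1))
  · have hinner := isInnerFace_leftOrbit hD σ (Nat.succ_pos k) (by omega)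
    obtain ⟨Ω', δ, A', B'⟩ := D
    cases hΩ
    exact mem_carrier_of_mem_openSq hδ hinner hopen
  · rcases eq_leftVert_of_not_mem_openSq hD σ (by omega) hz' hopen with he | he
    · rw [hzeq, he, leftVert]
      exact mem_carrier_of_midpoint_inner hΩ hδ (leftOrbit_valid hD σ (by omega)).1
        (isInnerFace_leftOrbit hD σ h1 (by omega)) (isInnerFace_leftOrbit hD σ (Nat.succ_pos k) (by omega))
    · rw [hzeq, he, leftVert]
      exact mem_carrier_of_midpoint_inner hΩ hδ (leftOrbit_valid hD σ (by omega)).1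
        (isInnerFace_leftOrbit hD σ (Nat.succ_pos k) (by omega)) (isInnerFace_leftOrbit hD σ (Nat.succ_pos _) (by omega))

/-- **The cut set lies in the domain.** [cite: Smirnov2001, §2] -/
theorem leftCut_subset_carrier (hΩ : D.Ω = Dm.carrier) (hD : D.IsZdAdmissible) (σ : SpinConfig (Site 2)) :
    leftCut D σ ⊆ Dm.carrier := by
  intro z hz
  obtain ⟨k, h1, hk, hz⟩ := mem_leftCut_iff.1 hz
  exact leftPiece_subset_carrier hΩ hD σ h1 hk hz

/-- The cut set misses the boundary curve. [cite: Smirnov2001, §2] -/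
theorem leftCut_disjoint_frontier (hΩ : D.Ω = Dm.carrier) (hD : D.IsZdAdmissible) (σ : SpinConfig (Site 2)) :
    Disjoint (leftCut D σ) (frontier Dm.carrier) :=
  Set.disjoint_left.2 fun _ hz hz' ↦
    Set.disjoint_left.1 Dm.disjoint_carrier_frontier (leftCut_subset_carrier hΩ hD σ hz) hz'

/-- **From a discrete boundary site to the boundary curve, off the cut set**: every site `u` of
`∂Ω_δ` is joined to a point `z ∈ ∂D` with `dist (z, δu) ≤ 2δ` by a straight segment missing the
cut set (the proof of the FK sibling `exists_frontier_near_of_mem_zdBoundary'`, with "a lattice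
edge meeting the cut set is an edge of `Ω_δ`" and "a closed face meeting the cut set is inner").
[cite: Smirnov2001, §2] -/
theorem exists_frontier_near_of_mem_zdBoundary_leftCut (hΩ : D.Ω = Dm.carrier) (hD : D.IsZdAdmissible)
    (σ : SpinConfig (Site 2)) {u : Site 2} (hu : u ∈ D.zdBoundary) :
    ∃ z ∈ frontier Dm.carrier, dist z (meshPoint D.δ u) ≤ 2 * D.δ ∧
      ∀ q ∈ segment ℝ (meshPoint D.δ u) z, q ∉ leftCut D σ := by
  have hδ := hD.delta_pos
  have hedge : ∀ {u' y : Site 2}, (zdGraph 2).Adj u' y → ∀ q ∈ segment ℝ (meshPoint D.δ u') (meshPoint D.δ y),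
      q ∈ leftCut D σ → (discreteDomainGraph D.Ω D.δ).Adj u' y :=
    fun {u' y} h q hq hqt ↦ adj_of_mem_leftCut_of_mem_segment hD σ h hqt hq
  have hface : ∀ {q : ℂ} {g : Site 2}, q ∈ leftCut D σ → D.δ⁻¹ • q ∈ closedSq g → D.IsInnerFace g :=
    fun {q g} hq hg ↦ isInnerFace_of_mem_leftCut_closedSq hD σ hq hg
  -- from here on, the argument of the FK sibling
  have huΩ : meshPoint D.δ u ∈ Dm.carrier := by
    rw [← hΩ]; exact meshDomain_subset_meshVertices _ _ (D.zdBoundary_subset_meshDomain hu)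
  have cross : ∀ {q : ℂ}, q ∉ Dm.carrier → ∃ z ∈ segment ℝ (meshPoint D.δ u) q, z ∈ frontier Dm.carrier := by
    intro q hq
    obtain ⟨z, hz1, hz2⟩ := Dm.inter_frontier_nonempty_of_isPreconnected
      (convex_segment (meshPoint D.δ u) q).isPreconnected ⟨_, left_mem_segment _ _ _, huΩ⟩
      ⟨q, right_mem_segment _ _ _, hq⟩
    exact ⟨z, hz1, hz2⟩
  rcases D.mem_zdBoundary_iff.1 hu with hu' | ⟨y, hadj, -, g, hg, hug, hyg⟩
  · -- `u ∈ meshBoundary`: a lattice neighbour `y` not `Ω_δ`-adjacent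
    obtain ⟨huD, y, hzd, hnadj⟩ := mem_meshBoundary_iff.1 hu'
    have hfree : ∀ q ∈ segment ℝ (meshPoint D.δ u) (meshPoint D.δ y), q ∉ leftCut D σ :=
      fun q hq hqt ↦ hnadj (hedge hzd q hq hqt)
    have hdist : dist (meshPoint D.δ y) (meshPoint D.δ u) = D.δ := by
      rw [dist_comm, dist_meshPoint_of_adj hzd, abs_of_pos hδ]
    by_cases hseg : segment ℝ (meshPoint D.δ u) (meshPoint D.δ y) ⊆ closure Dm.carrier
    · have hyΩ : meshPoint D.δ y ∉ Dm.carrier := by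
        intro hyΩ
        apply hnadj
        rw [discreteDomainGraph_adj_iff]
        have hmesh : (meshGraph D.Ω D.δ).Adj u y := meshGraph_adj_iff.2 ⟨hzd, hΩ ▸ hseg⟩
        exact ⟨hmesh, huD, mem_meshDomain_of_meshGraph_adj huD (hΩ ▸ hyΩ) hmesh⟩
      refine ⟨meshPoint D.δ y, ⟨hseg (right_mem_segment _ _ _), ?_⟩, hdist.le.trans (by linarith), hfree⟩
      rw [Dm.isOpen.interior_eq]; exact hyΩ
    · obtain ⟨q, hq, hqΩ⟩ := not_subset.1 hseg
      obtain ⟨z, hz, hzfr⟩ := cross (fun h => hqΩ (subset_closure h))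
      have hsub : segment ℝ (meshPoint D.δ u) z ⊆ segment ℝ (meshPoint D.δ u) (meshPoint D.δ y) :=
        (convex_segment _ _).segment_subset (left_mem_segment _ _ _)
          ((convex_segment _ _).segment_subset (left_mem_segment _ _ _) hq hz)
      refine ⟨z, hzfr, ?_, fun p hp => hfree p (hsub hp)⟩
      have hzball : z ∈ closedBall (meshPoint D.δ u) D.δ :=
        (convex_closedBall _ _).segment_subset (mem_closedBall.2 (by rw [dist_self]; exact hδ.le))
          (mem_closedBall.2 hdist.le) (hsub (right_mem_segment _ _ _))
      rw [mem_closedBall] at hzball; linarith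
  · -- `u` is a corner of a non-inner face `g`: some point of `g` is off `Ω`
    have huD : u ∈ meshDomain D.Ω D.δ := (discreteDomainGraph_adj_iff.1 hadj).2.1
    have hsq : ∃ q ∈ D.δ • closedSq g, q ∉ Dm.carrier := by
      by_contra hall
      push Not at hall
      apply hg
      have hvert : ∀ v, IsCorner v g → meshPoint D.δ v ∈ Dm.carrier := fun v hv =>
        hall _ (by rw [meshPoint_eq_smul]; exact Set.smul_mem_smul_set (toComplex_mem_closedSq hv))
      have hmesh : ∀ v w, IsCorner v g → IsCorner w g → (zdGraph 2).Adj v w → (meshGraph D.Ω D.δ).Adj v w := by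
        intro v w hv hw hvw
        refine meshGraph_adj_iff.2 ⟨hvw, fun p hp => ?_⟩
        rw [hΩ]
        refine subset_closure (hall p ?_)
        change p ∈ segment ℝ (meshPoint D.δ v) (meshPoint D.δ w) at hp
        rw [meshPoint_eq_smul, meshPoint_eq_smul, ← smul_segment_eq] at hp
        obtain ⟨p', hp', rfl⟩ := hp
        exact Set.smul_mem_smul_set ((convex_closedSq g).segment_subset (toComplex_mem_closedSq hv)
          (toComplex_mem_closedSq hw) hp')
      have hdom : ∀ v, IsCorner v g → v ∈ meshDomain D.Ω D.δ := by
        intro v hv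
        rcases Percolation.IsCorner.exists_adj_chain hug hv with rfl | h | ⟨c, hc, h1, h2⟩
        · exact huD
        · exact mem_meshDomain_of_meshGraph_adj huD (hΩ ▸ hvert v hv) (hmesh _ _ hug hv h)
        · exact mem_meshDomain_of_meshGraph_adj (mem_meshDomain_of_meshGraph_adj huD (hΩ ▸ hvert c hc) (hmesh _ _ hug hc h1))
            (hΩ ▸ hvert v hv) (hmesh _ _ hc hv h2)
      intro v w hv hw hvw
      exact discreteDomainGraph_adj_iff.2 ⟨hmesh v w hv hw hvw, hdom v hv, hdom w hw⟩
    obtain ⟨q, hq, hqΩ⟩ := hsq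
    obtain ⟨z, hz, hzfr⟩ := cross hqΩ
    have husq : meshPoint D.δ u ∈ D.δ • closedSq g := by
      rw [meshPoint_eq_smul]; exact Set.smul_mem_smul_set (toComplex_mem_closedSq hug)
    have hconv : Convex ℝ (D.δ • closedSq g) := (convex_closedSq g).smul D.δ
    have hsub : segment ℝ (meshPoint D.δ u) z ⊆ D.δ • closedSq g :=
      hconv.segment_subset husq (hconv.segment_subset husq hq hz)
    refine ⟨z, hzfr, ?_, fun p hp hpt => ?_⟩
    · have := closedSq_subset_closedBall hug ((Set.mem_smul_set_iff_inv_smul_mem₀ hδ.ne' _ _).1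
        (hsub (right_mem_segment _ _ _)))
      rw [mem_closedBall, ← mul_le_mul_iff_right₀ hδ, ← abs_of_pos hδ, ← Real.norm_eq_abs, ← dist_smul₀,
        Real.norm_eq_abs, abs_of_pos hδ, smul_inv_smul₀ hδ.ne', ← meshPoint_eq_smul] at this
      linarith
    · exact hg (hface hpt ((Set.mem_smul_set_iff_inv_smul_mem₀ hδ.ne' _ _).1 (hsub hp)))

end Carrier

end Literature.Probability.LatticeModels

end
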